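import Summits.BirchSwinnertonDyer.BirchSwinnertonDyer.Theorems.RamifiedHeegnerPairLeafRankOneUpperAtThreePartnerLowerTwoSplit
import HarnessLib

/-!
# Route `RamifiedHeegnerPair`, crux U₁ `LeafRankOneUpperAtThree` (stmt-BirchSwinnertonDyer-26022), line `splitkolyvagin` —
# the S2 EXIT on the TWIST-UNIT road: a twist-unit field that ALSO SPLITS `2` (TU₁|₂) supplies PL₀|₂, hence U₁ per curve on every
# mono-multiplicative-carrier row from PRINT + three named facts + ONE numerical twist-unit certificate — no S2, no L₀, no Σ

HONEST FRAMING. Theorems only; helper file (`--supports stmt-BirchSwinnertonDyer-26022 --as helper`); nothing is booked,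
no item is closed, BSD is not proved for any curve; CONDITIONAL on every displayed input. Lead prover bsd-line-rhp-p2 g8,
2026-08-28. Sibling of `…PartnerLowerTwoSplit.lean` (U₁ ⟸ PUB⁺ ∧ 3 facts ∧ Σ★″ ∧ PL₀|₂). The twist-unit datum of rhp-p2 g7 / the
SchneiderFree door (`SchneiderFree.Upper.TwistUnitFieldAt W 3`: a Heegner field of odd discriminant, `L(W^{(d)},1) ≠ 0`, and a member of
the class whose twist has `3`-unit `#Ш_an`) is re-typed here with ONE extra conjunct «`2` splits in `K`» (TU₁|₂, spelled inline; of
trib-w-rhp g11's census fields 353 of 355 have `d ≡ 1 (mod 8)`, kit j308272/j308656):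

* §1 `partnerLowerTwoSplit_of_twistUnitTwoSplit` — TU₁|₂(W) ⟹ PL₀|₂(W) (p634493's `partnerLower_of_twistUnit`, keeping the 2-split datum).
* §2 **`leafRankOneUpper_three_monoCarrier_of_namedFacts_of_twistUnitTwoSplit`** — U₁ AT ONE CURVE `W` on a mono-multiplicative-carrier row
  (`q ∥ N_E` carrying the `3`-part of `∏ c_ℓ`, the global Tamagawa binder, a datum with `3 ∤ c`) from the printed facts {GZ ∀, Kolyvagin ∀, GZK,
  Version L, GZ I.(7.3), Matar–Nekovář 0.7, Cassels} ∧ {Gross 3.7 (2), Poitou–Tate, GZ86 III (3.1)} ∧ TU₁|₂(W). This is the per-class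
  CERTIFICATE SHAPE for the 99 mono-carrier rank-one Gss2 classes (previously conditional on the reading-grade crux S2).
* §3 `leafRankOneUpperAtThree_of_pubManin_of_namedFacts_of_sigmaStar_of_twistUnitTwoSplit` — class-wide: U₁ BY NAME ⟸ PUB⁺ ∧ 3 facts ∧ Σ★″ ∧
  TU₁|₂ (∀ leaf r1 W). TU₁|₂ has surplus over the leaf (some Heegner twist with `Ш[3] = 0`), unlike PL₀|₂ — recorded, not preferred.

References: [cite: Jetchev2008, Thm. 1.4, Cor. 1.5 (p. 812)] [cite: GrossLMS1991, Prop. 3.7 (2) (p. 240), §6 p. 245] [cite: GrossZagier1986,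
III (3.1); Thm. I.(6.3) and (7.3)] [cite: MilneADT2006, Ch. I, Thm. 4.10(b); Thm. I.7.3 and Remark I.7.4] [cite: MatarNekovar2019, Thm. 0.7 (p. 456)]
[cite: KrizLi2019, Thm. 1.20] [cite: Miller2011LMS, §1 and Def. 1.1].
-/

-- D-0017: single-problem summit, so `Summit.BirchSwinnertonDyer.BirchSwinnertonDyer.…` repeats a namespace BY DESIGN.
set_option linter.dupNamespace false
set_option autoImplicit false

noncomputable section

open scoped Classical NumberField

open WeierstrassCurve IsDedekindDomain IsDedekindDomain.HeightOneSpectrum NumberField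
  Rat.HeightOneSpectrum Literature Literature.NumberTheory.EllipticCurves
  Literature.NumberTheory.EllipticCurves.ModularForms
  Literature.NumberTheory.EllipticCurves.Rank1Residual
  Literature.NumberTheory.EllipticCurves.Rank1Residual.Typed
  Literature.NumberTheory.EllipticCurves.KrizLi2019
  Literature.NumberTheory.QuadraticFields
  Summit.BirchSwinnertonDyer.Rank1Residual
  Summit.BirchSwinnertonDyer.Rank1Residual.Additive
  Summit.BirchSwinnertonDyer.Rank1Residual.X11b.Three
  Summit.BirchSwinnertonDyer.BirchSwinnertonDyer.Theses.RamifiedHeegnerPair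
  Summit.BirchSwinnertonDyer.BirchSwinnertonDyer.Theorems
  Summit.BirchSwinnertonDyer.BirchSwinnertonDyer.Theorems.SchneiderFree

namespace Summit.BirchSwinnertonDyer.BirchSwinnertonDyer.Theorems.RamifiedPairUpperBound

/-! ## §1 A twist-unit field splitting `2` supplies the partner-lower datum PL₀|₂ -/

/-- **PL₀|₂ ⟸ TU₁|₂ at `W`**: the split twist-unit datum with the field also splitting `2` (a Heegner `K`, odd `d_K`, `2` split, `L(W^{(d_K)},1) ≠ 0`,
a member `W₂ ∼ W` and a globally minimal model `W₂d` of `W₂^{(d_K)}` with `#Ш_an(W₂d)` a rational of non-positive `3`-adic valuation) gives a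
globally minimal model of `W^{(d_K)}` carrying its lower half (p630223 §1 `missingLowerBoundAt_twistModel_of_unitMember`: Cassels + GZK + Version L)
over the same field. = p634493's `partnerLower_of_twistUnit` keeping «`2` splits». [cite: MilneADT2006, Thm. I.7.3 and Remark I.7.4]
[cite: KrizLi2019, Thm. 1.20] [cite: Miller2011LMS, Def. 1.1] -/
theorem partnerLowerTwoSplit_of_twistUnitTwoSplit (hCassels : bsdRHS_eq_of_isIsogenous)
    (hGZK : rank_eq_analyticRank_of_analyticRank_le_one) (hmod : hasEntireLFunction_rat)
    (W : WeierstrassCurve ℚ) [W.IsElliptic] [W.IsGloballyMinimal]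
    (hTU : ∃ (K : Type) (_ : Field K) (_ : NumberField K) (W₂ W₂d : WeierstrassCurve ℚ) (_ : W₂.IsElliptic)
      (_ : W₂.IsGloballyMinimal) (_ : W₂d.IsElliptic) (_ : W₂d.IsGloballyMinimal),
      IsImaginaryQuadratic K ∧ Odd (NumberField.discr K) ∧ SatisfiesHeegnerHypothesis (W.conductorNorm ℤ) K ∧
      SatisfiesHeegnerHypothesis 2 K ∧ (W.quadraticTwist (NumberField.discr K : ℚ)).entireLFunction 1 ≠ 0 ∧
      IsIsogenous W W₂ ∧ (∃ C : VariableChange ℚ, C • W₂.quadraticTwist (NumberField.discr K : ℚ) = W₂d) ∧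
      ∃ qd : ℚ, shaAn W₂d = (qd : ℂ) ∧ padicValRat 3 qd ≤ 0) :
    ∃ (K : Type) (_ : Field K) (_ : NumberField K) (Wd : WeierstrassCurve ℚ) (_ : Wd.IsElliptic) (_ : Wd.IsGloballyMinimal),
      IsImaginaryQuadratic K ∧ Odd (NumberField.discr K) ∧ SatisfiesHeegnerHypothesis (W.conductorNorm ℤ) K ∧
      SatisfiesHeegnerHypothesis 2 K ∧ (W.quadraticTwist (NumberField.discr K : ℚ)).entireLFunction 1 ≠ 0 ∧
      (∃ C : VariableChange ℚ, C • W.quadraticTwist (NumberField.discr K : ℚ) = Wd) ∧ MissingLowerBoundAt Wd 3 := by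
  obtain ⟨K, _, _, W₂, W₂d, _, _, _, _, hK, hodd, hHN, hH2, hLt, hiso, ⟨C, hC⟩, qd, hqd, hv⟩ := hTU
  haveI : Fact (Nat.Prime 3) := ⟨Nat.prime_three⟩
  have hD0 : (NumberField.discr K : ℚ) ≠ 0 := by exact_mod_cast NumberField.discr_ne_zero K
  haveI hEt : (W.quadraticTwist (NumberField.discr K : ℚ)).IsElliptic := W.isElliptic_quadraticTwist hD0
  obtain ⟨Cd, hCd⟩ := hasGlobalMinimalModel_rat_holds (W.quadraticTwist (NumberField.discr K : ℚ))
  haveI : (Cd • W.quadraticTwist (NumberField.discr K : ℚ)).IsGloballyMinimal := hCd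
  have hrd : (Cd • W.quadraticTwist (NumberField.discr K : ℚ)).analyticRank = 0 := by
    rw [analyticRank_smul]
    exact analyticRank_eq_zero_of_entireLFunction_one_ne_zero _ hLt
  exact ⟨K, inferInstance, inferInstance, Cd • W.quadraticTwist (NumberField.discr K : ℚ), inferInstance, inferInstance, hK, hodd,
    hHN, hH2, hLt, ⟨Cd, rfl⟩, missingLowerBoundAt_twistModel_of_unitMember hCassels hGZK hmod hiso hD0 hC Cd (by omega) hqd hv⟩

/-! ## §2 Per curve: U₁ on a mono-multiplicative-carrier row from PRINT + three named facts + TU₁|₂(W) — the certificate shape -/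

/-- **U₁ AT ONE CURVE on a mono-multiplicative-carrier row from PRINT + THREE NAMED FACTS + ONE twist-unit certificate (field splitting `2`).**
For `W/ℚ` globally minimal, non-CM, leaf Gss2 at `3`, `r_an(W) = 1`; a prime `q ∥ N_E` with `ord₃ ∏_ℓ c_ℓ(E) ≤ ord₃ c_q(E)`; every Tamagawa-`3`
carrier multiplicative; a parametrisation datum at level `N_E` with `3 ∤ c`; and TU₁|₂(W): `Typed.MissingUpperBoundAt W 3` follows from the printed
named facts (Gross–Zagier ∀, Kolyvagin ∀, GZK, Version L, GZ I.(7.3), Matar–Nekovář 2019 Thm. 0.7, Cassels) and the three Literature facts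
{`GrossLMS1991.prop37_2_frobeniusCongruence`, `∀ K, poitouTate_selmerStructure_duality_conj K`, `Gross1991_heegnerPoint_sub_ratTorsion_mem_E0_imageFree`}.
NO S2 (27492), NO L₀ (26023), NO Σ. = the sibling's §2 (`…monoCarrier_of_twoSplitReading_of_partnerLowerTwoSplit`) ∘ {`twoSplitReading_of_namedFacts`, §1}.
Certificate shape for the 99 mono-carrier rank-one Gss2 classes of the census. CONDITIONAL on the displayed facts and data; nothing asserted
about any curve; BSD is not proved. [cite: Jetchev2008, Thm. 1.4 and Cor. 1.5 (p. 812)] [cite: GrossLMS1991, Prop. 3.7 (2) (p. 240)]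
[cite: MilneADT2006, Ch. I, Thm. 4.10(b); Thm. I.7.3] [cite: GrossZagier1986, III (3.1); Thm. I.(6.3) and (7.3)]
[cite: MatarNekovar2019, Thm. 0.7 (p. 456)] [cite: Miller2011LMS, Def. 1.1] -/
theorem leafRankOneUpper_three_monoCarrier_of_namedFacts_of_twistUnitTwoSplit
    (hGZ : ∀ (N : ℕ) [NeZero N] (W : WeierstrassCurve ℚ) (K : Type) [Field K] [NumberField K],
      gross_zagier N W K)
    (hKo : ∀ (N : ℕ) [NeZero N] (W : WeierstrassCurve ℚ) (K : Type) [Field K] [NumberField K],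
      kolyvagin N W K)
    (hGZK : rank_eq_analyticRank_of_analyticRank_le_one) (hmod : hasEntireLFunction_rat)
    (hGZ73 : GrossZagier1986_thm_I_7_3)
    (hMN : MatarNekovar2019.thm07_padicValNat_card_sha_primary_add_le_of_globalDivisibility_of_irreducible)
    (hCassels : bsdRHS_eq_of_isIsogenous)
    (h37 : GrossLMS1991.prop37_2_frobeniusCongruence)
    (hPT : ∀ (K : Type) [Field K] [NumberField K],
      Literature.NumberTheory.GaloisCohomology.poitouTate_selmerStructure_duality_conj K)
    (hF1 : Gross1991_heegnerPoint_sub_ratTorsion_mem_E0_imageFree)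
    (W : WeierstrassCurve ℚ) [W.IsElliptic] [W.IsGloballyMinimal] [NeZero (W.conductorNorm ℤ)]
    (hCM : ¬ W.HasCM) (hadd : Addv W 3) (hsub : SubGss W 3) (hr : W.analyticRank = 1)
    (q : ℕ) [Fact q.Prime] (hqN : q ∣ W.conductorNorm ℤ) (hq2 : ¬ q ^ 2 ∣ W.conductorNorm ℤ)
    (hmono : padicValNat 3 W.tamagawaProduct ≤ padicValNat 3 ((W.baseChange ℚ_[q]).localTamagawaNumber ℤ_[q]))
    (htam : ∀ (q' : ℕ) [Fact q'.Prime], q' ∣ W.conductorNorm ℤ →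
      3 ∣ (W.baseChange ℚ_[q']).localTamagawaNumber ℤ_[q'] → ¬ q' ^ 2 ∣ W.conductorNorm ℤ)
    (Dt : ModularParametrizationData W (W.conductorNorm ℤ)) (hc : ¬ (3 : ℤ) ∣ Dt.c)
    (hTU : ∃ (K : Type) (_ : Field K) (_ : NumberField K) (W₂ W₂d : WeierstrassCurve ℚ) (_ : W₂.IsElliptic)
      (_ : W₂.IsGloballyMinimal) (_ : W₂d.IsElliptic) (_ : W₂d.IsGloballyMinimal),
      IsImaginaryQuadratic K ∧ Odd (NumberField.discr K) ∧ SatisfiesHeegnerHypothesis (W.conductorNorm ℤ) K ∧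
      SatisfiesHeegnerHypothesis 2 K ∧ (W.quadraticTwist (NumberField.discr K : ℚ)).entireLFunction 1 ≠ 0 ∧
      IsIsogenous W W₂ ∧ (∃ C : VariableChange ℚ, C • W₂.quadraticTwist (NumberField.discr K : ℚ) = W₂d) ∧
      ∃ qd : ℚ, shaAn W₂d = (qd : ℂ) ∧ padicValRat 3 qd ≤ 0) :
    MissingUpperBoundAt W 3 :=
  leafRankOneUpper_three_monoCarrier_of_twoSplitReading_of_partnerLowerTwoSplit hGZ hKo hGZK hmod hGZ73 hMN
    (twoSplitReading_of_namedFacts h37 hPT hF1) W hCM hadd hsub hr q hqN hq2 hmono htam Dt hc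
    (partnerLowerTwoSplit_of_twistUnitTwoSplit hCassels hGZK hmod W hTU)

/-! ## §3 Class-wide: U₁ BY NAME ⟸ PUB⁺ ∧ three named facts ∧ Σ★″ ∧ TU₁|₂ -/

/-- **`LeafRankOneUpperAtThree` (26022) BY NAME ⟸ PUB⁺ (27491) ∧ {Gross 3.7 (2), Poitou–Tate, GZ86 III (3.1)} ∧ Σ★″ (27493) ∧ TU₁|₂** (every
non-CM leaf curve of analytic rank one has a twist-unit field splitting `2`; spelled inline). = the sibling's §4 with PL₀|₂ supplied by §1 (Cassels,
GZK, Version L from PUB⁺). TU₁|₂ has surplus over the leaf — the tight form is PL₀|₂. CONDITIONAL; U₁ stays OPEN; BSD is not proved.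
[cite: Jetchev2008, Conj. 1.3, Thm. 1.4 (p. 812)] [cite: GrossLMS1991, Prop. 3.7 (2)] [cite: MilneADT2006, Ch. I, Thm. 4.10(b); Thm. I.7.3]
[cite: MatarNekovar2019, Thm. 0.7 (p. 456)] [cite: KrizLi2019, Thm. 1.20] [cite: Miller2011LMS, Def. 1.1] -/
theorem leafRankOneUpperAtThree_of_pubManin_of_namedFacts_of_sigmaStar_of_twistUnitTwoSplit
    (hpub : LeafRankOnePrintedInputsAtThree)
    (h37 : GrossLMS1991.prop37_2_frobeniusCongruence)
    (hPT : ∀ (K : Type) [Field K] [NumberField K],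
      Literature.NumberTheory.GaloisCohomology.poitouTate_selmerStructure_duality_conj K)
    (hF1 : Gross1991_heegnerPoint_sub_ratTorsion_mem_E0_imageFree)
    (hStar : LeafSigmaStarDivisibilityAtThreeOptimalOffRows)
    (hTU : ∀ (W : WeierstrassCurve ℚ) [W.IsElliptic] [W.IsGloballyMinimal], ¬ W.HasCM →
      Literature.NumberTheory.EllipticCurves.Rank1Residual.Addv W 3 →
      Summit.BirchSwinnertonDyer.Rank1Residual.Additive.SubGss W 3 → W.analyticRank = 1 →
      ∃ (K : Type) (_ : Field K) (_ : NumberField K) (W₂ W₂d : WeierstrassCurve ℚ) (_ : W₂.IsElliptic)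
        (_ : W₂.IsGloballyMinimal) (_ : W₂d.IsElliptic) (_ : W₂d.IsGloballyMinimal),
        IsImaginaryQuadratic K ∧ Odd (NumberField.discr K) ∧ SatisfiesHeegnerHypothesis (W.conductorNorm ℤ) K ∧
        SatisfiesHeegnerHypothesis 2 K ∧ (W.quadraticTwist (NumberField.discr K : ℚ)).entireLFunction 1 ≠ 0 ∧
        IsIsogenous W W₂ ∧ (∃ C : VariableChange ℚ, C • W₂.quadraticTwist (NumberField.discr K : ℚ) = W₂d) ∧
        ∃ qd : ℚ, shaAn W₂d = (qd : ℂ) ∧ padicValRat 3 qd ≤ 0) :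
    LeafRankOneUpperAtThree := by
  obtain ⟨-, -, hGZK, hmod, -, -, -, -, -, hCassels, -, -, -⟩ := id hpub
  exact leafRankOneUpperAtThree_of_pubManin_of_namedFacts_of_sigmaStar_of_partnerLowerTwoSplit hpub h37 hPT hF1 hStar
    (fun W _ _ hCM hadd hsub hr ↦ partnerLowerTwoSplit_of_twistUnitTwoSplit hCassels hGZK hmod W (hTU W hCM hadd hsub hr))

end Summit.BirchSwinnertonDyer.BirchSwinnertonDyer.Theorems.RamifiedPairUpperBound

end
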